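import Summits.QuantumFields.YangMills.Theorems.LuscherReductionTwistedTraceScalingInnerBOPackage
import HarnessLib

/-!
# Negative-side bookkeeping R20 for C4 INNER: lane A's ★ `feshbach_endgame` (`…InnerBOPackage`, p599876) is TIGHT in the off-diagonal scale —
# with `b² ≥ 8·ε·θ·λ` (instead of `b² ≤ ε·θ·λ/16`) a TWO-LEVEL model satisfies every other hypothesis (FLOOR with equality) and carries an INTRUDER
# (crux `TwistedTraceScaling` stmt-QuantumFields-20203, skeleton «twolattice» rev 3, stub S-BASE, sub-target C4; disprover cycle 16, `Cruxes/TwistedTraceScaling/Disproof.lean` §T)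

`feshbach_endgame` closes the Born–Oppenheimer package `InnerBOPackageAt` (COARSE-DESIGN §21.3–§21.4): from STIFF `Qvv ≤ (1−θ)σμ₀Nv`, OFF-DIAG
`Q ≤ Quu + 2bσμ₀√Nu√Nv + Qvv`, SLOW `Quu ≤ e^{ελ/4}σμ_kNu`, FLOOR `e^{−ελ/4}σμ₀ ≤ Λ₀` and `b² ≤ εθλ/16` it derives `Q·μ₀ ≤ e^{ελ}·μ_k·Λ₀·N`.  This file shows the scale
`b² ≲ εθλ` is NECESSARY, not an artefact of the AM–GM weight: for `0 < θ`, `0 < ελ ≤ min(1, 2θ)`, every `b ≥ 0` with `8εθλ ≤ b² ≤ θ²/4` admits scalars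
`(Q, Quu, Qvv, N, Nu, Nv, σ, μ₀, μ_k, Λ₀)` — the Rayleigh data of the two-level form `[[e^{ελ/4}, b], [b, 1−θ]]` on the trial vector `(√(1−r²), r)`, `r = b/(e^{ελ/4}−1+θ)`,
with `σ = μ₀ = μ_k = N = 1`, `Λ₀ = e^{−ελ/4}` — satisfying ALL the other hypotheses of `feshbach_endgame` while `Q·μ₀ > e^{ελ}·μ_k·Λ₀·N` (★ `feshbach_endgame_false_without_b_small`:
the second-order shift `≥ b²/(2·gap) ≥ 2ελ` of the slow level exceeds the allowance `e^{3ελ/4} − e^{ελ/4} ≤ 3ελ/2`).  READING (Disproof §T, VERDICT 16): lane A's own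
scaling `b ≍ |c|` (COARSE-DESIGN §21.1 (N2), §21.3) meets `b² ≤ εθλ_b/16` only for `|c| ≲ (εθλ_b)^{1/2} ≍ β^{−1/6}`, while the door's box reaches `|c| ≍ β^{−p}`, `p < 2/51`;
by this file there is no slack in the endgame to absorb a larger `b` — the uniform `b` of OFF-DIAG must come from a different split off the bulk (slow cut, «brick R»).
Nothing here refutes `feshbach_endgame` (it is correct); this is its tightness in `b`.
HONEST FRAMING: scalar two-level algebra about a stub (S-BASE, C4) of a child of the CONDITIONAL reduction route R2b1; not `¬TwistedTraceScaling`, not a gap, not Clay.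

## References
* J. Sjöstrand, M. Zworski, *Elementary linear algebra for advanced spectral problems*, Ann. Inst. Fourier 57 (2007) 2095, §2. [SjostrandZworski2007]
* M. Lüscher, Nucl. Phys. B219 (1983) 233, §3. [Luscher1983]
-/

set_option autoImplicit false

namespace Summit.QuantumFields.YangMills.Theorems.TwistedTraceScaling.Negative.R20

open Real

/-- `exp y ≤ 1 + y + y²` for `0 ≤ y ≤ 1`. [folklore] -/
theorem exp_le_one_add_add_sq {y : ℝ} (hy0 : 0 ≤ y) (hy1 : y ≤ 1) : exp y ≤ 1 + y + y ^ 2 := by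
  have h := Real.abs_exp_sub_one_sub_id_le (x := y) (by rw [abs_of_nonneg hy0]; exact hy1)
  have h' := (abs_le.1 h).2
  linarith

/-- The allowance of the endgame is small: `e^{3x} − e^{x} ≤ 6x` for `0 ≤ x ≤ 1/4` (`x = ελ/4`). [folklore] -/
theorem exp_three_mul_sub_exp_le {x : ℝ} (hx0 : 0 ≤ x) (hx1 : x ≤ 1 / 4) : exp (3 * x) - exp x ≤ 6 * x := by
  have h3 := exp_le_one_add_add_sq (y := 3 * x) (by linarith) (by linarith)
  have h1 : x + 1 ≤ exp x := Real.add_one_le_exp x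
  nlinarith

/-- ★ **`feshbach_endgame` is tight in `b`**: with `8εθλ ≤ b²` (and `b ≤ θ/2`, `ελ ≤ 2θ`, `ελ ≤ 1`) there are data satisfying every other hypothesis of
`feshbach_endgame` — `σ = μ₀ = μ_k = N = 1`, `Λ₀ = e^{−ελ/4}` (FLOOR with equality), the two-level trial vector `(√(1−r²), r)`, `r = b/(e^{ελ/4} − 1 + θ)` — for which the
conclusion `Q·μ₀ ≤ e^{ελ}·μ_k·Λ₀·N` FAILS (an intruder: the slow level is pushed up by `≥ b²/(2·gap) ≥ 2ελ > e^{3ελ/4} − e^{ελ/4}`).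
[cite: SjostrandZworski2007, §2] [cite: Luscher1983, §3] -/
theorem feshbach_endgame_false_without_b_small {θ ε lam b : ℝ} (hθ : 0 < θ) (hε : 0 < ε) (hlam : 0 < lam)
    (hεlam : ε * lam ≤ 1) (hεθ : ε * lam ≤ 2 * θ) (hb : 0 ≤ b) (hbθ : b ≤ θ / 2) (hb2 : 8 * (ε * θ * lam) ≤ b ^ 2) :
    ∃ Q Quu Qvv N Nu Nv σ μ0 μk Λ0 : ℝ,
      0 ≤ σ ∧ 0 ≤ μ0 ∧ μ0 / 2 ≤ μk ∧ (1 - θ / 2) * μ0 ≤ μk ∧ 0 ≤ Nu ∧ 0 ≤ Nv ∧ Nu + Nv ≤ N ∧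
      Real.exp (-(ε / 4 * lam)) * (σ * μ0) ≤ Λ0 ∧ Qvv ≤ (1 - θ) * (σ * μ0) * Nv ∧
      Q ≤ Quu + 2 * (b * (σ * μ0)) * Real.sqrt Nu * Real.sqrt Nv + Qvv ∧
      Quu ≤ Real.exp (ε / 4 * lam) * (σ * μk) * Nu ∧
      ¬ (Q * μ0 ≤ Real.exp (ε * lam) * μk * Λ0 * N) := by
  -- notation: `x = ελ/4`, `a = e^x` (slow level), `d = a − 1 + θ` (gap to the stiff level `1 − θ`), `r = b/d` (stiff amplitude of the trial vector)
  obtain ⟨x, hx⟩ : ∃ x : ℝ, x = ε / 4 * lam := ⟨_, rfl⟩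
  have hx0 : 0 < x := by rw [hx]; positivity
  have hx1 : x ≤ 1 / 4 := by rw [hx]; nlinarith
  obtain ⟨a, ha⟩ : ∃ a : ℝ, a = Real.exp (ε / 4 * lam) := ⟨_, rfl⟩
  have ha1 : 1 + x ≤ a := by rw [ha, ← hx]; linarith [Real.add_one_le_exp x]
  have ha2 : a ≤ 1 + 2 * x := by
    have h := exp_le_one_add_add_sq (y := x) hx0.le (by linarith)
    rw [ha, ← hx]; nlinarith
  obtain ⟨d, hd⟩ : ∃ d : ℝ, d = a - 1 + θ := ⟨_, rfl⟩
  have hdθ : θ ≤ d := by rw [hd]; linarith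
  have hd2θ : d ≤ 2 * θ := by
    have h2x : 2 * x ≤ θ := by rw [hx]; linarith
    rw [hd]; linarith
  have hd0 : 0 < d := lt_of_lt_of_le hθ hdθ
  obtain ⟨r, hr⟩ : ∃ r : ℝ, r = b / d := ⟨_, rfl⟩
  have hr0 : 0 ≤ r := by rw [hr]; exact div_nonneg hb hd0.le
  have hr1 : r ≤ 1 / 2 := by rw [hr, div_le_iff₀ hd0]; linarith
  have hbr : b = r * d := by rw [hr]; field_simp
  have hr2 : r ^ 2 ≤ 1 / 4 := by nlinarith
  -- the data: `σ = μ₀ = μ_k = N = 1`, `Λ₀ = e^{−x}`, `Nu = 1 − r²`, `Nv = r²`, the blocks with EQUALITY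
  refine ⟨Real.exp (ε / 4 * lam) * (1 * 1) * (1 - r ^ 2) + 2 * (b * (1 * 1)) * Real.sqrt (1 - r ^ 2) * Real.sqrt (r ^ 2) + (1 - θ) * (1 * 1) * r ^ 2,
    Real.exp (ε / 4 * lam) * (1 * 1) * (1 - r ^ 2), (1 - θ) * (1 * 1) * r ^ 2, 1, 1 - r ^ 2, r ^ 2, 1, 1, 1, Real.exp (-(ε / 4 * lam)),
    zero_le_one, zero_le_one, by norm_num, by linarith, by linarith, sq_nonneg r, by linarith, by norm_num, le_rfl, le_rfl, le_rfl, ?_⟩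
  -- the intruder: `Q > e^{ελ}·e^{−ελ/4} = e^{3x}`
  intro hcon
  have hsr : Real.sqrt (r ^ 2) = r := Real.sqrt_sq hr0
  have hs1 : 1 - r ^ 2 ≤ Real.sqrt (1 - r ^ 2) := by
    have h0 : 0 ≤ 1 - r ^ 2 := by linarith
    calc 1 - r ^ 2 = Real.sqrt ((1 - r ^ 2) ^ 2) := (Real.sqrt_sq h0).symm
      _ ≤ Real.sqrt (1 - r ^ 2) := Real.sqrt_le_sqrt (by nlinarith)
  have hrhs : Real.exp (ε * lam) * 1 * Real.exp (-(ε / 4 * lam)) * 1 = Real.exp (3 * x) := by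
    rw [mul_one, mul_one, ← Real.exp_add]; congr 1; rw [hx]; ring
  have h3 : Real.exp (3 * x) ≤ a + 6 * x := by
    have h := exp_three_mul_sub_exp_le hx0.le hx1
    rw [ha, ← hx]; linarith
  -- lower bound for the cross term: `2 b √(1−r²) √(r²) ≥ 2 b r (1 − r²)`
  have hbr0 : 0 ≤ 2 * b * r := by positivity
  have hcross : 2 * b * r * (1 - r ^ 2) ≤ 2 * (b * (1 * 1)) * Real.sqrt (1 - r ^ 2) * Real.sqrt (r ^ 2) := by
    rw [hsr]
    have e : 2 * (b * (1 * 1)) * Real.sqrt (1 - r ^ 2) * r = 2 * b * r * Real.sqrt (1 - r ^ 2) := by ring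
    rw [e]
    exact mul_le_mul_of_nonneg_left hs1 hbr0
  -- the algebra: with `b = r d`, `a(1−r²) + 2 b r (1−r²) + (1−θ) r² = a + r² d (1 − 2r²) ≥ a + r² d / 2`
  have hkey1 : 4 * (ε * lam) ≤ r ^ 2 * d := by
    -- `r² d · d = b² ≥ 8εθλ` and `d ≤ 2θ`
    have e : r ^ 2 * d * d = b ^ 2 := by rw [hbr]; ring
    have h1 : 8 * (ε * θ * lam) ≤ r ^ 2 * d * d := by rw [e]; exact hb2
    by_contra hlt
    have hlt' : r ^ 2 * d < 4 * (ε * lam) := lt_of_not_ge hlt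
    have : r ^ 2 * d * d < 4 * (ε * lam) * d := mul_lt_mul_of_pos_right hlt' hd0
    have : 4 * (ε * lam) * d ≤ 4 * (ε * lam) * (2 * θ) := mul_le_mul_of_nonneg_left hd2θ (by positivity)
    nlinarith
  have hkey2 : 8 * x ≤ r ^ 2 * d * (1 - 2 * r ^ 2) := by
    have h1 : 1 / 2 ≤ 1 - 2 * r ^ 2 := by linarith
    have h2 : 0 ≤ r ^ 2 * d := by positivity
    have h3' : r ^ 2 * d * (1 / 2) ≤ r ^ 2 * d * (1 - 2 * r ^ 2) := mul_le_mul_of_nonneg_left h1 h2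
    have h4 : 16 * x = 4 * (ε * lam) := by rw [hx]; ring
    linarith
  have hQ : a + 8 * x ≤ a * (1 - r ^ 2) + 2 * b * r * (1 - r ^ 2) + (1 - θ) * r ^ 2 := by
    have e : a * (1 - r ^ 2) + 2 * b * r * (1 - r ^ 2) + (1 - θ) * r ^ 2 = a + r ^ 2 * d * (1 - 2 * r ^ 2) := by
      rw [hbr, hd]; ring
    rw [e]; linarith
  -- assemble
  rw [mul_one, hrhs, ← ha] at hcon
  have e1 : a * (1 * 1) * (1 - r ^ 2) = a * (1 - r ^ 2) := by ring
  have e2 : (1 - θ) * (1 * 1) * r ^ 2 = (1 - θ) * r ^ 2 := by ring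
  rw [e1, e2] at hcon
  linarith

end Summit.QuantumFields.YangMills.Theorems.TwistedTraceScaling.Negative.R20
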